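import Summits.BirchSwinnertonDyer.BirchSwinnertonDyer.Theorems.PrintX8SharpFlatMuTransfer
import Summits.BirchSwinnertonDyer.BirchSwinnertonDyer.Theorems.SignedLowerHalvesKobayashiMainConjectureSmallImageSignedMuDefect
import Summits.BirchSwinnertonDyer.Rank1Residual.CoatesSujathaConjectureA
import Literature.NumberTheory.EllipticCurves.IwasawaModuleFinitePadicIntProofs
import Literature.NumberTheory.EllipticCurves.FineSelmerClassGroupCriterion
import Literature.NumberTheory.EllipticCurves.FineSelmerCongruentCurves
import Literature.NumberTheory.IwasawaTheory.ClassicalMuInvariantOnePrimeProofs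
import HarnessLib

/-!
# Route `PrintX8`, crux `MuBoundSmallImageX8` (stmt-BirchSwinnertonDyer-20622, the `μ`-child of 20402):
# the RIDER-FREE road — the `μ`-bound on the small-image X8 pairs from Coates–Sujatha's statement (A) at
# `(E, 3)`, and statement (A) per pair from ONE class number / from a `3`-congruent partner
# (cell `bsd-print-x8`, D-0131 (2) print tier, prover seat p2 gen 2; `--supports` 20622; route-independent
# imports; closes nothing)

PARTITION (cell bsd-print-x8, leaf `ClassX8` = K3 row A8 = W-ALL row 8; 217 census cells, 61 with image
`N_ns⁺(3)` = the domain of 20622): types the object of the `μ`-child; closes NONE; 0 census cells move;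
BSD is not proved by any of this.

HONEST FRAMING. Seat p2: «♯♭ ⊇-half from Kato via Sprung's ♯♭ Coleman maps + ♯♭ control ⇒ …». On the
61 small-image cells the Kato-side «⊇» is known only up to `3ⁿ` (Sprung 2012 Thm. 7.16; (12.5.2) fails:
image ∩ `SL₂(𝔽₃) = Q₈`), and the route's residual beyond K1 is now the `μ`-child 20622 («`μ(X^•) ≤
μ(Λ/(L^•))`», planner g2 rev 8/9). This file is the ♯/♭ TWIN of cell `bsd-ssimc`'s parts 6–7
(`SignedLowerHalvesKobayashiMainConjectureSmallImageSignedMuDefect/…ConjA.lean`, seat k3-c4x, `a_p = 0`)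
for EVERY supersingular `a_p`, over p1 g2's construction fact
`Sprung2012.thm714seq_sharpFlatColemanKato_zeta` (p543968: Sprung 2012 Def. 6.1 + Props. 7.3/7.6 +
(3) of Thm. 7.14 at `η = 1` + Kato Thm. 12.6 on the PINNED `𝐇¹_Γ(T_pW)` / `X^•` / `X₀`), and its rider
is NOT the analytic one of p1's `PrintX8SharpFlatMuTransfer` («`μ(L^•_3(E)) = 0`», Perrin-Riou 2003
Conj. 7.1) but Coates–Sujatha's statement (A) at `(E, 3)` — «the Pontryagin dual of the FINE Selmer group
`Sel₀(ℚ_∞, E[3^∞])` is finitely generated over `ℤ₃`» (`μ(X₀(E/ℚ_∞)) = 0`; Math. Ann. 331 (2005); OPEN;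
tree node `Summit.BirchSwinnertonDyer.Rank1Residual.FineSelmer.CoatesSujathaConjectureA`) — which the
analytic rider IMPLIES on the domain (p1's §1 through the reduction-free core) and which has two PER-PAIR
supplies that are `L`-function-free:
(i) ONE CLASS NUMBER: `3 ∤ h(ℚ(E[3]))` and one prime of `ℚ(E[3])` above `3` ⟹ `μ_class = 0` for every
`ℤ₃`-tower of `ℚ(E[3])` (Iwasawa 1956 / Greenberg 2001 Prop. 2.1 — the tree THEOREM
`IwasawaTheory.iwasawa1956_…_holds`) ⟹ (A) (Coates–Sujatha Thm. 3.4, named fact); on X8 ∩ {¬surj(3)} the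
decomposition group at `3` is the whole image `N_ns⁺(3)` (`e = 8`, `f = 2`), so the second clause holds
on the class and the certificate is the single integer `h(ℚ(E[3])) mod 3` (degree-16 field; this seat's
kit census, HOME/p2); Wuthrich, MRL 13 (2006) Prop. 7 is the ORDINARY twin of exactly this situation
(«image in the normaliser of a Cartan subgroup … `ℚ(E[p])` an abelian extension of an imaginary quadratic
field», divisibility conditional on Iwasawa's `μ`-statement for such fields);
(ii) a `3`-CONGRUENT PARTNER `E′` with (A) at `(E′, 3)` (Lim–Sujatha 2018 Prop. 3.2 — the tree THEOREM
`LimSujatha2018.prop32_…_holds`; K3 c5's CM partners, ty1 g3's pointer).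

* §1 `μ`-bookkeeping on the pinned objects (twin of K3 part 6 §2): for every ♯/♭ package
  `K : SharpFlatColemanKatoData …` and every height-one prime `𝔭`,
  `length_𝔭 X^• + length_𝔭 (𝐇¹/Z) = length_𝔭 X₀ + length_𝔭 Λ/(G₁)` (`G₁` = Néron-normalised `L^•`)
  and the rider-free bound `length_𝔭 X^• ≤ length_𝔭 X₀ + length_𝔭 Λ/(G₁)` — image-free, colour by
  colour; at `𝔭 = (3)`: `μ(X^•) ≤ μ(X₀) + μ(Λ/(L^•))`.
* §2 per pair on X8 (ANY image, ANY rank): (A) at `(W, 3)` ⟹ the `μ`-bound for every colour with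
  `L^• ≠ 0` (`X8.muBound_of_conjA`), below `hCK` and the period unit at `3` only; (A) from one class
  number (`conjA_of_not_dvd_classNumber_of_unique_prime`, any `E/ℚ`, odd `p`) and from a congruent
  partner (`conjA_of_congruent`).
* The class forms BY NAME (20622 ⟸ (A) on the small-image X8 pairs / ⟸ the tree node / ⟸ Iwasawa's
  `μ = 0` for the `3`-division fields / ⟸ per-pair class-number certificates / ⟸ congruent partners;
  20402 ⟸ K1 + (A) + `PublishedInputsX8` through glue 20623) are the sibling GLUE file
  `PrintX8SmallImageMuBoundConjAGlue.lean` (imports the route file; this file is route-independent).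
READING (planner / tribunal t2): the `μ`-child is implied by a NAMED classical statement — Coates–Sujatha
(A) at `p = 3` on the 61 curves, itself implied by Iwasawa's 1973 `μ = 0` for `ℚ(E[3])` (degree 16,
`SD₁₆`, cyclic of degree 8 over an imaginary quadratic field in which `3` is inert); class-wide both are
OPEN (Ferrero–Washington covers only fields abelian over `ℚ`); per pair (A) is certified by ONE class
number. The two riders of the cell MEET at (A): analytic (p1) ⟹ (A) ⟹ `μ`-bound. Beyond-print theorem:
NO (kernel module theory over named facts; (A) not asserted). PARTITION: 0 cells.

References: [Sprung2012] Def. 6.1, Props. 7.3/7.6/7.17/7.19, Thm. 7.14 (3) (pp. 1495–1505);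
[Kato2004Asterisque] Thm. 12.6, §17.13 (p. 280); [Kobayashi2003] proof of Thm. 7.4 (p. 13);
[CoatesSujatha2005] §3 (A), Thm. 3.4; [KuriharaPollack2007] §3.1; [Greenberg2001IwasawaPastPresent]
Prop. 2.1; [LimSujatha2018] Prop. 3.2; [Wuthrich2006] Thm. 2, Prop. 7; [LeiSujatha2021] §1; tree:
`Sprung2012/SharpFlatColemanKatoZeta.lean` (p543968), `PrintX8SharpFlatMuTransfer.lean` (p545102),
K3 parts 6–7 (k3-c4x), `PrintX8MuGlue.lean` (p3 g1), `FineSelmerClassGroupCriterion.lean`,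
`FineSelmerCongruentCurves.lean`, `IwasawaTheory/ClassicalMuInvariantOnePrimeProofs.lean`,
`Rank1Residual/CoatesSujathaConjectureA.lean`.
-/

set_option linter.dupNamespace false
set_option autoImplicit false

noncomputable section

open scoped Classical NumberField MatrixGroups ModularForm

open NumberField IsDedekindDomain WeierstrassCurve CongruenceSubgroup Field
  Literature.NumberTheory.EllipticCurves Literature.NumberTheory.EllipticCurves.ModularForms
  Literature.NumberTheory.EllipticCurves.Rank1Residual
  Literature.NumberTheory.EllipticCurves.Sprung2017 Literature.NumberTheory.EllipticCurves.Sprung2012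
  Literature.NumberTheory.EllipticCurves.Kato2004 Literature.NumberTheory.EllipticCurves.GreenbergVatsal2000
  Literature.NumberTheory.EllipticCurves.ZpExtension Literature.NumberTheory.EllipticCurves.IwasawaAlgebra
  Literature.NumberTheory.EllipticCurves.Module
  Literature.NumberTheory.IwasawaTheory
  Summit.BirchSwinnertonDyer.BirchSwinnertonDyer.Rank1Residual
  Summit.BirchSwinnertonDyer.BirchSwinnertonDyer.Theorems
  Summit.BirchSwinnertonDyer.BirchSwinnertonDyer.Theorems.SmallImageSignedMuDefect
  Summit.BirchSwinnertonDyer.Rank1Residual.Supersingular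

namespace Summit.BirchSwinnertonDyer.BirchSwinnertonDyer.Theorems.PrintX8MuBoundConjA

/-! ### §1 `μ`-bookkeeping on the pinned objects: every package of `thm714seq_sharpFlatColemanKato_zeta` -/

section Package

variable (W : WeierstrassCurve ℚ) [W.IsElliptic] (p : ℕ) [Fact p.Prime]

/-- **The ♯/♭ `μ`/`λ`-defect identity, prime by prime (Kato §17.13 p. 280 ∕ Sprung Prop. 7.19 on the
pinned objects; twin of `SmallImageSignedMuDefect.signedSelmerDual_lengthAt_add_eq`).** For every
package `K : SharpFlatColemanKatoData W p f ϖ κ γ ι a_p g c • I` (Sprung 2012 Def. 6.1 + Props. 7.3/7.6 +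
(3) of Thm. 7.14 with Kato Thm. 12.6 — the fact `thm714seq_sharpFlatColemanKato_zeta`), with `E[p]`
irreducible, every Sprung pair `(L♯, L♭)` of `f` with `L^• ≠ 0` (so `col` is injective) and Néron
normalisation `G₁` (`ι G₁ = C(ϖ)·ι L^•`), every dual datum `D` of `Sel^•(E/ℚ_∞)`, every dual datum `Y`
of `Sel₀(ℚ_∞, E[p^∞])` and every height-one prime `𝔭` of `Λ`:
`length_𝔭 X^• + length_𝔭 (𝐇¹/Z) = length_𝔭 X₀ + length_𝔭 Λ/(G₁)`.
At `𝔭 = (p)`: `μ(X^•) + μ(𝐇¹/Z) = μ(X₀) + μ(L^•)`. No image hypothesis, no rider; CONDITIONAL only on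
the package. [cite: Sprung2012, Thm. 7.14 (3) (p. 1504) and Prop. 7.19 (p. 1505)]
[cite: Kato2004Asterisque, Thm. 12.6 (p. 222) and §17.13 (p. 280)] [cite: Kobayashi2003, proof of Thm. 7.4 (p. 13)] -/
theorem sharpFlatSelmerDual_lengthAt_add_eq
    [ContinuousSMul ℤ_[p] (W.tateModule p)] [Module.Free ℤ_[p] (W.tateModule p)]
    [Module.Finite ℤ_[p] (W.tateModule p)]
    {N : ℕ} {f : CuspForm (Gamma0 N) 2} {ϖ : ℚ} {κ : ZpExtension ℚ p} {γ : absoluteGaloisGroup ℚ}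
    {E : Type} [Field E] [Algebra ℚ E] {ι : AlgebraicClosure ℚ →ₐ[ℚ] AlgebraicClosure E} {ap : ℤ}
    {g : absoluteGaloisGroup E} {c : ℕ → localPoints W E} {col : Chroma} {I : IwasawaH1Data W p κ γ}
    (K : SharpFlatColemanKatoData W p f ϖ κ γ ι ap g c col I)
    (hirr : W.HasIrreducibleModPGaloisRep p) {Lsharp Lflat G₁ : IwasawaAlgebra p}
    (hSP : IsSprungPair f p ap Lsharp Lflat) (hcol : chromaticL col Lsharp Lflat ≠ 0)
    (hG₁ : iwasawaToPowerSeries p G₁ =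
      PowerSeries.C ((ϖ : ℚ) : ℚ_[p]) * iwasawaToPowerSeries p (chromaticL col Lsharp Lflat))
    (D : SharpFlatSelmerDualData W κ γ ι ap g c col) (Y : W.FineSelmerDualData κ γ)
    (𝔭 : PrimeSpectrum (IwasawaAlgebra p)) (h𝔭 : 𝔭.asIdeal.height = 1) :
    lengthAt (IwasawaAlgebra p) D.X 𝔭 + lengthAt (IwasawaAlgebra p) (I.H ⧸ K.Z) 𝔭 =
      lengthAt (IwasawaAlgebra p) Y.X 𝔭 +
        lengthAt (IwasawaAlgebra p) (IwasawaAlgebra p ⧸ Ideal.span {G₁}) 𝔭 := by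
  obtain ⟨j, k, hcj, hjk, hk⟩ := K.exact D Y
  obtain ⟨s, hs, hsG, hZG⟩ := K.image_zeta_localized hirr Lsharp Lflat G₁ hSP hG₁ 𝔭 h𝔭
  exact lengthAt_add_lengthAt_quotient_eq_of_exact K.colMap (K.colMap_injective Lsharp Lflat hSP hcol)
    j k hcj hjk hk K.Z 𝔭 hs hsG hZG

/-- **Rider-free bound: the `μ`-defect of the colour-`•` main [C] is at most `μ` of the FINE Selmer
group** (twin of `SmallImageSignedMuDefect.signedSelmerDual_lengthAt_le_fine_add`). Same setting:
`length_𝔭 X^• ≤ length_𝔭 X₀ + length_𝔭 Λ/(G₁)` at every height-one `𝔭` (drop the `𝐇¹/Z` term).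
At `𝔭 = (p)`: `μ(X^•) ≤ μ(X₀) + μ(L^•)` at ANY image of `ρ̄_{E,p}`; Kato's INTEGRAL divisibility
(Sprung Thm. 7.16 with `n = 0`) would give `μ(X^•) ≤ μ(L^•)` but needs `GL₂(ℤ_p)`-surjectivity.
[cite: Sprung2012, Thm. 7.16 (p. 1504) and Prop. 7.19 (p. 1505)] [cite: Kato2004Asterisque, §17.13 (p. 280)] -/
theorem sharpFlatSelmerDual_lengthAt_le_fine_add
    [ContinuousSMul ℤ_[p] (W.tateModule p)] [Module.Free ℤ_[p] (W.tateModule p)]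
    [Module.Finite ℤ_[p] (W.tateModule p)]
    {N : ℕ} {f : CuspForm (Gamma0 N) 2} {ϖ : ℚ} {κ : ZpExtension ℚ p} {γ : absoluteGaloisGroup ℚ}
    {E : Type} [Field E] [Algebra ℚ E] {ι : AlgebraicClosure ℚ →ₐ[ℚ] AlgebraicClosure E} {ap : ℤ}
    {g : absoluteGaloisGroup E} {c : ℕ → localPoints W E} {col : Chroma} {I : IwasawaH1Data W p κ γ}
    (K : SharpFlatColemanKatoData W p f ϖ κ γ ι ap g c col I)
    (hirr : W.HasIrreducibleModPGaloisRep p) {Lsharp Lflat G₁ : IwasawaAlgebra p}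
    (hSP : IsSprungPair f p ap Lsharp Lflat) (hcol : chromaticL col Lsharp Lflat ≠ 0)
    (hG₁ : iwasawaToPowerSeries p G₁ =
      PowerSeries.C ((ϖ : ℚ) : ℚ_[p]) * iwasawaToPowerSeries p (chromaticL col Lsharp Lflat))
    (D : SharpFlatSelmerDualData W κ γ ι ap g c col) (Y : W.FineSelmerDualData κ γ)
    (𝔭 : PrimeSpectrum (IwasawaAlgebra p)) (h𝔭 : 𝔭.asIdeal.height = 1) :
    lengthAt (IwasawaAlgebra p) D.X 𝔭 ≤
      lengthAt (IwasawaAlgebra p) Y.X 𝔭 +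
        lengthAt (IwasawaAlgebra p) (IwasawaAlgebra p ⧸ Ideal.span {G₁}) 𝔭 := by
  rw [← sharpFlatSelmerDual_lengthAt_add_eq W p K hirr hSP hcol hG₁ D Y 𝔭 h𝔭]
  exact le_self_add

end Package

/-! ### §2 Per pair: statement (A) at `(E, p)` replaces the analytic rider -/

section PerPair

variable (W : WeierstrassCurve ℚ) [W.IsElliptic] [W.IsGloballyMinimal] (p : ℕ) [Fact p.Prime]

/-- **`length_(p) X₀(E/ℚ_∞) = 0 ⟹ μ(X^•) ≤ μ(Λ/(L^•))` — the `μ`-part of Kato's ♯/♭ divisibility at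
ANY image, from the vanishing of the fine `μ`-invariant** (twin of K3's
`signed_lengthAt_le_of_fine_lengthAt_eq_zero`). Odd good `p` with `p ∣ a_p`, newform `f` with a period
ratio `ϖ` of `p`-adic norm `1` (displayed: `hϖ1`), the cyclotomic / Honda setting of Sprung 2012 Thm.
2.2, colour `•`, Sprung pair with `L^• ≠ 0`: if SOME dual fine Selmer datum `Y` over `(κ, γ)` has
`length_(p) X₀ = 0` then every dual datum `D` of `Sel^•(E/ℚ_∞)` has `μ(D.X) ≤ μ(Λ/(L^•))`. Binders:
the construction fact `hCK` only (`E[p]` irreducible is derived from `p ∣ a_p`; `G₁ := C(u)·L^•`,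
`u = ϖ`, has `(G₁) = (L^•)`). [cite: Sprung2012, Thm. 7.14 (3) (p. 1504) and Prop. 7.19 (p. 1505)]
[cite: Kato2004Asterisque, Thm. 12.6 (p. 222) and §17.13 (p. 280)] -/
theorem sharpFlat_muInvariant_le_of_fine_lengthAt_eq_zero (hCK : thm714seq_sharpFlatColemanKato_zeta)
    (hp : p ≠ 2) (hgood : W.HasGoodReductionAtPrime p) (hap : (p : ℤ) ∣ W.frobeniusTrace p)
    {N : ℕ} [NeZero N] (f : CuspForm (Gamma0 N) 2) (hf : IsNewformOf W f)
    (ϖ : ℚ) (hϖ : (ϖ : ℝ) * W.realPeriodRat = plusPeriod f) (hϖ1 : ‖(ϖ : ℚ_[p])‖ = 1)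
    (κ : ZpExtension ℚ p) (γ : absoluteGaloisGroup ℚ) (hκ : κ.IsCyclotomic) (hγ : κ.IsTopGenerator γ)
    (hγ' : IsCyclotomicVariable p γ)
    (v : HeightOneSpectrum (𝓞 ℚ)) (hv : (p : 𝓞 ℚ) ∈ v.asIdeal)
    (g : absoluteGaloisGroup (v.adicCompletion ℚ))
    (hg : κ.IsTopGenerator (resGalOfEmb (closureEmb (K := ℚ) (v.adicCompletion ℚ)) g))
    (cneg : localPoints W (v.adicCompletion ℚ)) (c : ℕ → localPoints W (v.adicCompletion ℚ))
    (hH : IsHondaSystem κ (closureEmb (K := ℚ) (v.adicCompletion ℚ)) W (W.frobeniusTrace p) g cneg c)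
    (col : Chroma) {Lsharp Lflat : IwasawaAlgebra p}
    (hSP : IsSprungPair f p (W.frobeniusTrace p) Lsharp Lflat) (hcol : chromaticL col Lsharp Lflat ≠ 0)
    (D : SharpFlatSelmerDualData W κ γ (closureEmb (K := ℚ) (v.adicCompletion ℚ))
      (W.frobeniusTrace p) g c col)
    (Y : W.FineSelmerDualData κ γ)
    (hY : lengthAt (IwasawaAlgebra p) Y.X ⟨augIdealP p, isPrime_augIdealP_holds p⟩ = 0) :
    muInvariant p D.X ≤ muInvariant p (IwasawaAlgebra p ⧸ Ideal.span {chromaticL col Lsharp Lflat}) := by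
  haveI : ContinuousSMul ℤ_[p] (W.tateModule p) := TateModule.continuousSMul_padicInt
  haveI : Module.Free ℤ_[p] (W.tateModule p) := W.module_free_tateModule_holds p
  haveI : Module.Finite ℤ_[p] (W.tateModule p) := W.module_finite_tateModule_holds p
  -- supersingular ⟹ `E[p]` irreducible
  have hirr : W.HasIrreducibleModPGaloisRep p :=
    hasIrreducibleModPGaloisRep_of_dvd_frobeniusTrace W p hp
      (W.not_dvd_minimalDiscriminantInt_of_hasGoodReductionAtPrime' p hgood) hap
  -- the pinned `𝐇¹_Γ(T_pW)` and the ♯/♭ package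
  obtain ⟨I⟩ := nonempty_iwasawaH1Data_holds W p κ γ hκ hγ
  obtain ⟨K⟩ := hCK W p f ϖ κ γ hp hgood hap hf hϖ hκ hγ hγ' v hv g hg cneg c hH col I
  -- `G₁ := C(u)·L^•`, `u = ϖ` a `p`-adic unit: Néron-normalised and `(G₁) = (L^•)`
  set L : IwasawaAlgebra p := chromaticL col Lsharp Lflat with hLdef
  obtain ⟨hspan, hι⟩ := span_C_units_mul_eq (PadicInt.mkUnits hϖ1) L
  have hG₁ : iwasawaToPowerSeries p (PowerSeries.C ((PadicInt.mkUnits hϖ1 : ℤ_[p]ˣ) : ℤ_[p]) * L) =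
      PowerSeries.C ((ϖ : ℚ) : ℚ_[p]) * iwasawaToPowerSeries p L := by rw [hι, PadicInt.mkUnits_eq]
  let 𝔭 : PrimeSpectrum (IwasawaAlgebra p) := ⟨augIdealP p, isPrime_augIdealP_holds p⟩
  have h𝔭1 : 𝔭.asIdeal.height = 1 := by exact height_augIdealP_holds p
  have h := sharpFlatSelmerDual_lengthAt_le_fine_add W p K hirr hSP hcol hG₁ D Y 𝔭 h𝔭1
  rw [hY, zero_add, hspan] at h
  -- lengths at `(p)` ↦ `μ`
  rw [muInvariant_eq_toNat_lengthAt p D.X 𝔭 rfl,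
    muInvariant_eq_toNat_lengthAt p (IwasawaAlgebra p ⧸ Ideal.span {L}) 𝔭 rfl]
  have hby : Module.IsTorsionBy (IwasawaAlgebra p) (IwasawaAlgebra p ⧸ Ideal.span {L}) L :=
    (Module.isTorsionBy_quotient_iff _ L).mpr fun y ↦ by
      rw [smul_eq_mul]
      exact Ideal.mul_mem_right y _ (Ideal.mem_span_singleton_self L)
  have hfin : lengthAt (IwasawaAlgebra p) (IwasawaAlgebra p ⧸ Ideal.span {L}) 𝔭 ≠ ⊤ :=
    lengthAt_ne_top_of_isTorsionBy hcol hby 𝔭 (le_of_eq h𝔭1)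
  exact ENat.toNat_le_toNat h hfin

/-- **X8 (ANY `3`-adic image, ANY analytic rank): statement (A) at `(W, 3)` ⟹ the `μ`-bound at the pair
for every colour with `L^• ≠ 0`** — the body of the route's `μ`-child `MuBoundSmallImageX8` at one pair,
with NO analytic rider and NO K1. (A) is consumed in the EXACT spelling of the tree node
`FineSelmer.CoatesSujathaConjectureA` instantiated at `(ℚ, W, 3, κ)`: SOME dual datum of
`Sel₀(ℚ_∞, W[3^∞])` over the cyclotomic `κ` is finitely generated over `ℤ₃`; by Lim–Sujatha §3 / Greenberg
§1 (tree `exists_fineSelmerDualData_moduleFinite_iff_finite_pTorsion`) this is the datum-free finiteness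
of `Sel₀(ℚ_∞, W[3^∞])[3]`, whence `length_(3) X₀ = 0` for EVERY datum (`lengthAt_eq_zero_of_finite_quotient_p`)
and the previous theorem applies; the period ratio for the newform at hand comes from the period fact at
`3` (`h3`). Binders: `hCK`, `h3`; displayed: `hA`. [cite: CoatesSujatha2005, §3 statement (A)]
[cite: LimSujatha2018, §3 (before Prop. 3.2)] [cite: Sprung2012, Thm. 7.14 (3) and Prop. 7.19 (pp. 1504–1505)]
[cite: GreenbergVatsal2000, §3 Remark 3.4] -/
theorem X8.muBound_of_conjA (hCK : thm714seq_sharpFlatColemanKato_zeta)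
    (h3 : realPeriodRat_eq_unit_mul_plusPeriod_three) (hX : ClassX8 W p)
    (hA : ∀ κ : ZpExtension ℚ p, κ.IsCyclotomic →
      ∃ (γ' : absoluteGaloisGroup ℚ) (D' : W.FineSelmerDualData κ γ'),
        Module.Finite ℤ_[p] (RestrictScalars ℤ_[p] (IwasawaAlgebra p) D'.X))
    (col : Chroma) (κ : ZpExtension ℚ p) (γ : absoluteGaloisGroup ℚ) (hκ : κ.IsCyclotomic)
    (hγ : κ.IsTopGenerator γ) (hγ' : IsCyclotomicVariable p γ)
    (v : HeightOneSpectrum (𝓞 ℚ)) (hv : (p : 𝓞 ℚ) ∈ v.asIdeal)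
    (g : absoluteGaloisGroup (v.adicCompletion ℚ))
    (hg : κ.IsTopGenerator (resGalOfEmb (closureEmb (K := ℚ) (v.adicCompletion ℚ)) g))
    (cneg : localPoints W (v.adicCompletion ℚ)) (c : ℕ → localPoints W (v.adicCompletion ℚ))
    (hH : IsHondaSystem κ (closureEmb (K := ℚ) (v.adicCompletion ℚ)) W (W.frobeniusTrace p) g cneg c)
    (N : ℕ) (hN : NeZero N) (f : CuspForm (Gamma0 N) 2) (Lsharp Lflat : IwasawaAlgebra p)
    (hf : IsNewformOf W f) (hSP : IsSprungPair f p (W.frobeniusTrace p) Lsharp Lflat)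
    (hcol : chromaticL col Lsharp Lflat ≠ 0)
    (D : SharpFlatSelmerDualData W κ γ (closureEmb (K := ℚ) (v.adicCompletion ℚ))
      (W.frobeniusTrace p) g c col) :
    muInvariant p D.X ≤ muInvariant p (IwasawaAlgebra p ⧸ Ideal.span {chromaticL col Lsharp Lflat}) := by
  haveI := hN
  have hp3 : p = 3 := hX.1
  subst hp3
  have hp2 : (3 : ℕ) ≠ 2 := by decide
  have hgood : W.HasGoodReductionAtPrime 3 := hX.2.1.1
  have hdvd : ((3 : ℕ) : ℤ) ∣ W.frobeniusTrace 3 := hX.2.1.2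
  -- a period ratio for `f` from the period fact at `3`, a `3`-adic unit
  obtain ⟨u, hu1, hΩ⟩ := h3 W hgood (ClassX8.irr W 3 hX) f hf
  have hu0 : (u : ℝ) ≠ 0 := by
    intro h
    have h0 : u = 0 := by exact_mod_cast h
    rw [h0] at hu1
    simp at hu1
  have hϖ : ((u⁻¹ : ℚ) : ℝ) * W.realPeriodRat = plusPeriod f := by
    rw [hΩ, Rat.cast_inv, ← mul_assoc, inv_mul_cancel₀ hu0, one_mul]
  have hϖ1 : ‖((u⁻¹ : ℚ) : ℚ_[3])‖ = 1 := by
    rw [Rat.cast_inv, norm_inv, hu1, inv_one]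
  -- (A) at this `κ`: `Sel₀(ℚ_∞, W[3^∞])[3]` finite, hence `length_(3) X₀ = 0` for the datum over `γ`
  obtain ⟨Y⟩ := W.nonempty_fineSelmerDualData κ hγ
  have hfinA : Set.Finite {s : W.fineSelmerInfty κ | 3 • s = 0} :=
    (IwasawaModuleFinitePadicInt.exists_fineSelmerDualData_moduleFinite_iff_finite_pTorsion W κ hγ).mp
      (hA κ hκ)
  haveI : Module.Finite (IwasawaAlgebra 3) Y.X := Y.module_finite_of_finite_pTorsion hγ hfinA
  haveI : Finite (Y.X ⧸ (augIdealP 3 • (⊤ : Submodule (IwasawaAlgebra 3) Y.X))) :=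
    Y.finite_quotient_augIdealP_of_finite_pTorsion hfinA
  have hY : lengthAt (IwasawaAlgebra 3) Y.X ⟨augIdealP 3, isPrime_augIdealP_holds 3⟩ = 0 :=
    KatoMuSkeleton.lengthAt_eq_zero_of_finite_quotient_p (M := Y.X) _ rfl
  exact sharpFlat_muInvariant_le_of_fine_lengthAt_eq_zero W 3 hCK hp2 hgood hdvd f hf u⁻¹ hϖ hϖ1 κ γ
    hκ hγ hγ' v hv g hg cneg c hH col hSP hcol D Y hY

/-- **The Iwasawa–Greenberg class-number road to (A), for ANY elliptic `E/ℚ` and ANY odd prime `p`.**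
If `p ∤ h(ℚ(E[p]))` and EXACTLY ONE prime of `ℚ(E[p])` lies above `p`, then every layer of every
`ℤ_p`-extension of `L = ℚ(E[p])` has `p`-class-number exponent `0` (Iwasawa 1956 / Greenberg 2001 Prop.
2.1 / Washington Prop. 13.22 — the tree THEOREM
`IwasawaTheory.iwasawa1956_classNumberPExp_eq_zero_of_not_dvd_classNumber_of_unique_prime_holds`), so
Iwasawa's classical `μ` of `L_cyc/L` vanishes, so (Coates–Sujatha 2005 Thm. 3.4, named fact `hCS`) the
dual fine Selmer group of `E` over `ℚ_cyc` is finitely generated over `ℤ_p`: statement (A) at `(E, p)`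
in the tree's `∃ γ D` spelling. No local `p`-torsion condition (contrast Deo–Ray–Sujatha 2023 Thm. 3.9's
(c3)), no anchor, no congruence: the per-pair certificate is ONE class number.
[cite: CoatesSujatha2005, Thm. 3.4 (§3)] [cite: KuriharaPollack2007, §3.1 (chapter p. 26)]
[cite: Greenberg2001IwasawaPastPresent, Prop. 2.1 p. 339] -/
theorem conjA_of_not_dvd_classNumber_of_unique_prime
    (hCS : CoatesSujatha2005.thm34_fineSelmerDual_moduleFinite_of_classicalMuVanishes_divisionField)
    (W : WeierstrassCurve ℚ) [W.IsElliptic] (p : ℕ) [Fact p.Prime] [NeZero p] (hp : p ≠ 2)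
    (hh : haveI : NumberField (W.divisionField p) := NumberField.mk
      ¬ p ∣ NumberField.classNumber (W.divisionField p))
    (hv : ∃! v : HeightOneSpectrum (𝓞 (W.divisionField p)),
      ((p : ℕ) : 𝓞 (W.divisionField p)) ∈ v.asIdeal)
    (κ : ZpExtension ℚ p) (hκ : κ.IsCyclotomic) :
    ∃ (γ : absoluteGaloisGroup ℚ) (D : W.FineSelmerDualData κ γ),
      Module.Finite ℤ_[p] (RestrictScalars ℤ_[p] (IwasawaAlgebra p) D.X) := by
  haveI : NumberField (W.divisionField p) := NumberField.mk
  -- `NeZero p` is a `Prop`: the instance inside `hCS`'s binder and the ambient one agree definitionally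
  refine hCS W p hp ?_ κ hκ
  intro κL _
  exact classicalMuVanishes_of_classNumberPExp_eq_zero
    iwasawa1956_classNumberPExp_eq_zero_of_not_dvd_classNumber_of_unique_prime_holds hh hv κL

/-- **The congruence road to (A)** (Lim–Sujatha 2018 Prop. 3.2, the tree THEOREM
`LimSujatha2018.prop32_fineSelmerDual_moduleFinite_iff_of_torsionIso_holds`): for an odd prime `p` and a
`Γ_ℚ`-equivariant isomorphism `W[p] ≃ W′[p]`, statement (A) at `(W′, p)` over the cyclotomic `κ` gives
(A) at `(W, p)` — no image, reduction or `a_p` hypothesis. Per pair the certificate is a congruent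
partner `W′` whose (A) is known (e.g. K3 c5's CM partners with a signed `μ = 0` reading, ty1 g3).
[cite: LimSujatha2018, §3 Prop. 3.2] -/
theorem conjA_of_congruent (W W' : WeierstrassCurve ℚ) [W.IsElliptic] [W'.IsElliptic]
    (p : ℕ) [Fact p.Prime] (hp : p ≠ 2)
    (he : ∃ e : geomTorsion W (p : ℤ) ≃+ geomTorsion W' (p : ℤ),
      ∀ (σ : absoluteGaloisGroup ℚ) (P : geomTorsion W (p : ℤ)), e (σ • P) = σ • e P)
    (κ : ZpExtension ℚ p) (hκ : κ.IsCyclotomic)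
    (hA' : ∃ (γ : absoluteGaloisGroup ℚ) (D : W'.FineSelmerDualData κ γ),
      Module.Finite ℤ_[p] (RestrictScalars ℤ_[p] (IwasawaAlgebra p) D.X)) :
    ∃ (γ : absoluteGaloisGroup ℚ) (D : W.FineSelmerDualData κ γ),
      Module.Finite ℤ_[p] (RestrictScalars ℤ_[p] (IwasawaAlgebra p) D.X) :=
  (LimSujatha2018.prop32_fineSelmerDual_moduleFinite_iff_of_torsionIso_holds W W' p hp he κ hκ).mpr hA'

end PerPair


end Summit.BirchSwinnertonDyer.BirchSwinnertonDyer.Theorems.PrintX8MuBoundConjA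

end
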